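import Literature.MathematicalPhysics.QuantumFieldTheory.Balaban1983to89.T4ReflectionConeSharp
import Literature.MathematicalPhysics.QuantumFieldTheory.Balaban1983to89.Node00.TkOfRecord

/-!
# NODE 00 — THE TWO-BLOCK WINDOW OF THE AVERAGING OF RECORD ON A BLOCK-SATURATED REGION, and the face it gives def-T's
# RESTRICTED AVERAGING `avgRestrOfRecord` (FILE 11a): on its image bonds the restriction (field extended by `1` off `sV`) IS the
# true average — the extension by `1` is never read

Cell `pub-ymgap`, YM-PLAN Track A (D-0062), seat `pub-ymgap-dag-n11-e` (g20; R134 N11 [B14] s3; count-neutral; `--supports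
stmt-QuantumFields-20542`).  NEW leaf over landed files, CONSUMED BY NAME and not modified: pub-balaban's
`T4ReflectionConeSharp.avgFun_congr₂` (the TIGHT locality of [Balaban1987RG1] (0.4): `Ū(c)` reads exactly the bonds with BOTH
endpoints in `B(c₋) ∪ B(c₊)`; `Setup.Averaging.local_dep` asks the larger set of bonds ISSUING from the two blocks),
`B10Eq42TorusConstraint.bondsIn` (the level-`j` bonds of a fine region `X ⊂ T_η`: both endpoints, read through
`B10Eq38TorusDomains.toFine`, in `X`), def-T's `Node00.DatumAvLayer.avOfRecord` (`= blockAvg expMeanLogSU`, `avOfRecord_avg` is `rfl`)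
and def-T's FILE 11a `Node00.TkOfRecord` (`avgRestrOfRecord F N K j sV sV'` = the averaging of record of the level-`j` field EXTENDED
BY `1` OFF the bond set `sV`, read on `sV'`; `genDataOfRecord`: `sV = bondsIn j (Ω_{j+1})ᶜ`, `sV' = bondsIn (j+1) (Ω_{j+1})ᶜ`).

WHY (dag-n11-e g20 CHECK-1, pub-ymgap INBOX 2026-08-28 l.30188; dag-n11-d g14's fibre-chart transport `…N11KernelTransportInFibreChart`).
[Balaban1988Convergent] §3 (3.1) p. 264 integrates ALL level-`k` bond variables against `δ(V̄_kV_{k+1}⁻¹)`, while the operator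
`𝐓^{(k)}` of (2.21) p. 258 keeps as conditional integrals only the variables on `Ω^c_{k+1}` («`∫dV_k|_{Ω^c_{k+1} ∩ X} δ(V̄_kV_{k+1}⁻¹)`»);
def-T's 11a models the latter by the kernel transport along `avgRestrOfRecord`, whose averaging FREEZES at `1` every level-`k`
variable off `sV`.  For the two readings to meet (the operator half of N11's 𝐓-image identity, print p. 267 «we remove the
δ-functions using the operator C»), the coarse bonds of `sV'` must NOT read any frozen variable.  They do not: by the tight
two-block window, a coarse bond with both endpoints in a region SATURATED by level-`(j+1)` blocks reads only fine bonds with both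
endpoints in that region (§1), so on `sV'` the restricted averaging equals the true one for EVERY completion of the field off
`sV` (§2) — the boundary-crossing fine bonds belong to the inner (charted) transport, as in print.

CONTENTS (theorems only; 0 `def`).
§1 (generic lattice `P`, level `j` in the standing range `j + 1 ≤ m + K`, any gauge group, any small-loop average `ℰ`)
   `avgFun_congr_of_eqOn_bondsIn`: for a fine region `Y` SATURATED at level `j+1` — the displayed hypothesis
   `hY : ∀ s, toFine j s ∈ Y ↔ toFine (j+1) (blockOf s) ∈ Y` («`Y` read on `T^{(j)}` is a union of blocks», true for def-R's
   cube unions) — two level-`j` fields agreeing on `bondsIn j Y` have the same (0.4) average at every bond of `bondsIn (j+1) Y`;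
   `blockAvg_congr_of_eqOn_bondsIn` (the same for the `Averaging` structure `blockAvg ℰ`).
§2 (of record, `G = SU(N)`) `avOfRecord_congr_of_eqOn_bondsIn`; ★ `avgRestrOfRecord_apply_eq_avOfRecord`: for finite bond sets
   `sV ⊇ bondsIn j Y`, `sV' ⊆ bondsIn (j+1) Y` and `Y` saturated, `avgRestrOfRecord F N K j sV sV' (U ∘ (↑)) c' = (avOfRecord F N K j).avg U c'`
   for every field `U` and every `c' ∈ sV'`; `avgRestrOfRecord_apply_eq_of_eqOn` (two completions of the same `sV`-datum give the
   same restricted average — immediate, recorded for consumers); ★ `avgRestrOfRecord_genData_apply_eq_avOfRecord`: the instance at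
   11a's `genDataOfRecord` bond sets `sV = bondsIn j (Ω_{j+1})ᶜ`, `sV' = bondsIn (j+1) (Ω_{j+1})ᶜ` under saturation of `(Ω_{j+1})ᶜ`.

HONEST FRAMING.  Lattice bookkeeping over landed definitions ([folklore]; the (0.4) cites are locators of the averaging, not claims);
the saturation of def-R's regions is DISPLAYED (`hY`), not proved here; nothing of Bałaban's estimates; the operator-half identity of
[III] §3 is NOT proved by this file (it removes one obstruction to stating it over 11a's data); N11 NOT discharged; K1⁷ NOT closed;
counts unmoved (typed 28∕28 · discharged 5∕27).  One finite `𝕋⁴` programme at fixed `ε`; R4 = the conditional finite-𝕋⁴ rung only —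
NOT ℝ⁴ ∕ OS ∕ mass gap ∕ Clay.  No `sorry`, no `axiom`, no `def`, no `instance`, no `notation`.
-/

noncomputable section

namespace Literature.MathematicalPhysics.QuantumFieldTheory.Balaban1983to89.Node00

open T4Continuum BlockAveraging
open B10Eq42TorusConstraint (bondsIn mem_bondsIn_iff)
open B10Eq38TorusDomains (toFine)

/-! ## §1  Generic: the (0.4) average at a bond of a block-saturated region reads only the bonds of that region -/

section Generic

variable {P : Params} {j : ℕ} {G : Type*} [GaugeGroup G]

/-- **THE TWO-BLOCK WINDOW ON A SATURATED REGION.**  If the fine region `Y ⊂ T_η`, read on `T^{(j)}`, is a union of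
level-`(j+1)` blocks (`hY`), then two level-`j` configurations that agree on the bonds of `bondsIn j Y` have the same (0.4) block
average at every bond of `bondsIn (j+1) Y`: by `T4ReflectionConeSharp.avgFun_congr₂` the average at `c` reads only bonds with both
endpoints in `B(c₋) ∪ B(c₊)`, and both blocks lie in `Y`. [cite: Balaban1987RG1, (0.4) p.253 (bookkeeping)] -/
theorem avgFun_congr_of_eqOn_bondsIn (ℰ : LoopAverage G) (hj : j + 1 ≤ P.m + P.K) {Y : Set (Site P 0)}
    (hY : ∀ s : Site P j, toFine j s ∈ Y ↔ toFine (j + 1) (blockOf s) ∈ Y)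
    {U U' : GaugeField P j G} (hUU' : ∀ b : PBond P j, b ∈ bondsIn j Y → U b = U' b)
    {c : PBond P (j + 1)} (hc : c ∈ bondsIn (j + 1) Y) :
    avgFun ℰ U c = avgFun ℰ U' c := by
  rw [mem_bondsIn_iff] at hc
  have hblk : ∀ x : Site P j, (blockOf x = c.src ∨ blockOf x = c.tgt) → toFine j x ∈ Y := by
    intro x hx
    refine (hY x).2 ?_
    rcases hx with h | h
    · rw [h]; exact hc.1
    · rw [h]; exact hc.2
  refine T4ReflectionConeSharp.avgFun_congr₂ ℰ hj U U' c fun b h₁ h₂ => hUU' b ?_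
  rw [mem_bondsIn_iff]
  exact ⟨hblk _ h₁, hblk _ h₂⟩

/-- The same for the `Averaging` structure `blockAvg ℰ` (its map is `avgFun ℰ`). [cite: Balaban1987RG1, (0.4) p.253 (bookkeeping)] -/
theorem blockAvg_congr_of_eqOn_bondsIn (ℰ : LoopAverage G) (hj : j + 1 ≤ P.m + P.K) {Y : Set (Site P 0)}
    (hY : ∀ s : Site P j, toFine j s ∈ Y ↔ toFine (j + 1) (blockOf s) ∈ Y)
    {U U' : GaugeField P j G} (hUU' : ∀ b : PBond P j, b ∈ bondsIn j Y → U b = U' b)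
    {c : PBond P (j + 1)} (hc : c ∈ bondsIn (j + 1) Y) :
    (blockAvg ℰ).avg U c = (blockAvg ℰ).avg U' c := by
  rw [blockAvg_avg]
  exact avgFun_congr_of_eqOn_bondsIn ℰ hj hY hUU' hc

end Generic

/-! ## §2  Of record: def-T's restricted averaging equals the true averaging of record on its image bonds -/

section OfRecord

variable (F : T4Family) (N : ℕ) [NeZero N]

/-- The averaging of record on a saturated region reads only the bonds of the region (§1 at `avOfRecord = blockAvg expMeanLogSU`).
[cite: Balaban1987RG1, (0.4) p.253 (bookkeeping)] -/
theorem avOfRecord_congr_of_eqOn_bondsIn (K j : ℕ) (hj : j + 1 ≤ (F.P K).m + (F.P K).K) {Y : Set (Site (F.P K) 0)}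
    (hY : ∀ s : Site (F.P K) j, toFine j s ∈ Y ↔ toFine (j + 1) (blockOf s) ∈ Y)
    {U U' : GaugeField (F.P K) j (SU N)} (hUU' : ∀ b : PBond (F.P K) j, b ∈ bondsIn j Y → U b = U' b)
    {c : PBond (F.P K) (j + 1)} (hc : c ∈ bondsIn (j + 1) Y) :
    (avOfRecord F N K j).avg U c = (avOfRecord F N K j).avg U' c := by
  rw [avOfRecord_avg]
  exact avgFun_congr_of_eqOn_bondsIn _ hj hY hUU' hc

/-- Two completions of the same `sV`-datum `y` have the same restricted average (immediate from the definition: `avgRestrOfRecord`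
reads `y` only) — recorded so that consumers may pick any completion. [cite: Balaban1988Convergent, (2.21) p.258 (bookkeeping)] -/
theorem avgRestrOfRecord_apply (K j : ℕ) [DecidableEq (PBond (F.P K) j)] (sV : Finset (PBond (F.P K) j))
    (sV' : Finset (PBond (F.P K) (j + 1))) (y : ↥sV → SU N) (c' : ↥sV') :
    avgRestrOfRecord F N K j sV sV' y c' = (avOfRecord F N K j).avg (Function.updateFinset (fun _ => 1) sV y) c' := rfl

/-- **★ ON ITS IMAGE BONDS THE RESTRICTED AVERAGING OF RECORD IS THE TRUE AVERAGE.**  For finite bond sets `sV ⊇ bondsIn j Y` (level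
`j`) and `sV' ⊆ bondsIn (j+1) Y` (level `j+1`) over a fine region `Y` saturated at level `j+1`, and EVERY level-`j` field `U`:
`avgRestrOfRecord F N K j sV sV' (U ∘ (↑)) c' = (avOfRecord F N K j).avg U c'` at every `c' ∈ sV'` — the extension by `1` off `sV`
inside `avgRestrOfRecord` is never read.  (The field is recovered from its `sV`-restriction by `Function.updateFinset`, which agrees with
`U` on `sV`.) [cite: Balaban1988Convergent, (2.21) p.258, (3.1) p.264 (bookkeeping)] -/
theorem avgRestrOfRecord_apply_eq_avOfRecord (K j : ℕ) [DecidableEq (PBond (F.P K) j)] (hj : j + 1 ≤ (F.P K).m + (F.P K).K)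
    {Y : Set (Site (F.P K) 0)} (hY : ∀ s : Site (F.P K) j, toFine j s ∈ Y ↔ toFine (j + 1) (blockOf s) ∈ Y)
    {sV : Finset (PBond (F.P K) j)} (hsV : ∀ b : PBond (F.P K) j, b ∈ bondsIn j Y → b ∈ sV)
    {sV' : Finset (PBond (F.P K) (j + 1))} (hsV' : ∀ c : PBond (F.P K) (j + 1), c ∈ sV' → c ∈ bondsIn (j + 1) Y)
    (U : GaugeField (F.P K) j (SU N)) (c' : ↥sV') :
    avgRestrOfRecord F N K j sV sV' (fun b => U b) c' = (avOfRecord F N K j).avg U c' := by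
  rw [avgRestrOfRecord_apply]
  refine avOfRecord_congr_of_eqOn_bondsIn F N K j hj hY (fun b hb => ?_) (hsV' _ c'.2)
  rw [Function.updateFinset_def]
  show (if hi : b ∈ sV then U (⟨b, hi⟩ : ↥sV) else 1) = U b
  rw [dif_pos (hsV b hb)]

/-- The same with the `sV`-datum given as a function `y` on `sV` and ANY completion `U` of it (`U b = y ⟨b, _⟩` on `sV`).
[cite: Balaban1988Convergent, (2.21) p.258 (bookkeeping)] -/
theorem avgRestrOfRecord_apply_eq_avOfRecord_of_eqOn (K j : ℕ) [DecidableEq (PBond (F.P K) j)]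
    (hj : j + 1 ≤ (F.P K).m + (F.P K).K)
    {Y : Set (Site (F.P K) 0)} (hY : ∀ s : Site (F.P K) j, toFine j s ∈ Y ↔ toFine (j + 1) (blockOf s) ∈ Y)
    {sV : Finset (PBond (F.P K) j)} (hsV : ∀ b : PBond (F.P K) j, b ∈ bondsIn j Y → b ∈ sV)
    {sV' : Finset (PBond (F.P K) (j + 1))} (hsV' : ∀ c : PBond (F.P K) (j + 1), c ∈ sV' → c ∈ bondsIn (j + 1) Y)
    (y : ↥sV → SU N) (U : GaugeField (F.P K) j (SU N)) (hUy : ∀ b : ↥sV, U b = y b) (c' : ↥sV') :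
    avgRestrOfRecord F N K j sV sV' y c' = (avOfRecord F N K j).avg U c' := by
  have hy : y = fun b : ↥sV => U b := funext fun b => (hUy b).symm
  rw [hy]
  exact avgRestrOfRecord_apply_eq_avOfRecord F N K j hj hY hsV hsV' U c'

/-- **★ AT 11a's GENERATION DATA OF RECORD.**  For a sequence of record `s` and a level `j` (standing range) at which the complement
`(Ω_{j+1})ᶜ` is saturated by level-`(j+1)` blocks, the restricted averaging of `genDataOfRecord … s S j` (V-bonds `bondsIn j (Ω_{j+1})ᶜ`,
image bonds `bondsIn (j+1) (Ω_{j+1})ᶜ`) equals the true averaging of record at every image bond, for every completion of the field: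
the conditional V-integrations of `𝐓^{(j)}` ((2.21)) see the same constraint as (3.1)'s full `δ(V̄_jV_{j+1}⁻¹)` there.
[cite: Balaban1988Convergent, (2.21) p.258, (3.1) p.264 (bookkeeping)] -/
theorem avgRestrOfRecord_genData_apply_eq_avOfRecord {V : Type} (ν : Stage7Numerics) (M : ℕ) (g : ℕ → ℝ) (K : ℕ)
    (W : TkWeights F N V K) {k : ℕ} (s : SeqOfRecord F ν M g K k) (S : ℕ → Set (Site (F.P K) 0)) (j : ℕ)
    [DecidableEq (PBond (F.P K) j)] (hj : j + 1 ≤ (F.P K).m + (F.P K).K)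
    (hY : ∀ x : Site (F.P K) j, toFine j x ∈ (s.Ω (j + 1))ᶜ ↔ toFine (j + 1) (blockOf x) ∈ (s.Ω (j + 1))ᶜ)
    (U : GaugeField (F.P K) j (SU N)) (c' : ↥(genDataOfRecord F N V ν M g K W s S j).sV') :
    avgRestrOfRecord F N K j (genDataOfRecord F N V ν M g K W s S j).sV (genDataOfRecord F N V ν M g K W s S j).sV'
        (fun b => U b) c' = (avOfRecord F N K j).avg U c' := by
  refine avgRestrOfRecord_apply_eq_avOfRecord F N K j hj hY (fun b hb => ?_) (fun c hc => ?_) U c'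
  · show b ∈ (Set.toFinite (bondsIn j (s.Ω (j + 1))ᶜ)).toFinset
    rw [Set.Finite.mem_toFinset]; exact hb
  · have hc' : c ∈ (Set.toFinite (bondsIn (j + 1) (s.Ω (j + 1))ᶜ)).toFinset := hc
    rw [Set.Finite.mem_toFinset] at hc'; exact hc'

end OfRecord

/-! ## §3 (v1.1, append-only)  The saturation hypothesis `hY` from the tree's two block-union predicates

The displayed hypothesis `hY : ∀ s, toFine j s ∈ Y ↔ toFine (j+1) (blockOf s) ∈ Y` of §§1–2 holds for every fine region that is a
union of `L^{j+1}`-cubes in the sense of `B10Eq38TorusDomains.IsBlockUnion (L^(j+1))` (the currency of `B10Eq68TorusRegularity`) and for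
every region that is a union of `(j+1)`-blocks in the sense of `B14.Eq22Determines.IsBlockUnion (j+1)` (the currency of the [15]
determining-set files); the §2 faces are re-issued in both currencies.  `blockIter_toFine` is the label identity `B^j(toFine j y) = y`
(the tree's `B15Eq177GaugeInvariance.blockIter_embIter` read through `toFine = embIter`, re-derived here to keep the imports minimal). -/

section Saturation

variable {P : Params}

/-- `B^j(toFine j y) = y`: the level-`j` block of the fine representative of a level-`j` site is the site (standing range; induction on
`j` with `Site.blockOf_emb`). [cite: Balaban1987RG1, (0.1) p.252 (bookkeeping)] -/
theorem blockIter_toFine : ∀ (j : ℕ), j ≤ P.m + P.K → ∀ y : Site P j, B14.Eq22Determines.blockIter j (toFine j y) = y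
  | 0, _, _ => rfl
  | j + 1, hj, y => by
      rw [B10Eq38TorusDomains.toFine_succ, B14.Eq22Determines.blockIter_succ,
        blockIter_toFine j (Nat.le_of_succ_le hj) (emb y), Site.blockOf_emb hj]

/-- **SATURATION FROM `L^{j+1}`-CUBE STRUCTURE**: a fine region that is a union of `L^{j+1}`-cubes (`B10Eq38TorusDomains.IsBlockUnion`)
satisfies §1's `hY`. [cite: Balaban1985UV3, (39) p.266 (bookkeeping)] -/
theorem toFine_mem_iff_of_isBlockUnion_pow {j : ℕ} (hj : j + 1 ≤ P.m + P.K) {Y : Set (Site P 0)}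
    (hY : B10Eq38TorusDomains.IsBlockUnion (P.L ^ (j + 1)) Y) (s : Site P j) :
    toFine j s ∈ Y ↔ toFine (j + 1) (blockOf s) ∈ Y := by
  refine hY ?_
  rw [← B10Eq71TorusOverlap.blockIter_eq_iff_cubeIdx hj (toFine j s) (blockOf s), B14.Eq22Determines.blockIter_succ,
    blockIter_toFine j (Nat.le_of_succ_le hj) s]

/-- **SATURATION FROM `(j+1)`-BLOCK STRUCTURE**: a fine region that is a union of `(j+1)`-blocks (`B14.Eq22Determines.IsBlockUnion (j+1)`)
satisfies §1's `hY`. [cite: Balaban1988Convergent, (2.1) p.255 (bookkeeping)] -/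
theorem toFine_mem_iff_of_isBlockUnion_level {j : ℕ} (hj : j + 1 ≤ P.m + P.K) {Y : Set (Site P 0)}
    (hY : B14.Eq22Determines.IsBlockUnion (j + 1) Y) (s : Site P j) :
    toFine j s ∈ Y ↔ toFine (j + 1) (blockOf s) ∈ Y := by
  have h₁ : B14.Eq22Determines.blockIter (j + 1) (toFine j s) = blockOf s := by
    rw [B14.Eq22Determines.blockIter_succ, blockIter_toFine j (Nat.le_of_succ_le hj) s]
  have h₂ : B14.Eq22Determines.blockIter (j + 1) (toFine (j + 1) (blockOf s)) = blockOf s := blockIter_toFine (j + 1) hj (blockOf s)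
  rw [hY (toFine j s), hY (toFine (j + 1) (blockOf s)), h₁, h₂]

end Saturation

section OfRecordSaturated

variable (F : T4Family) (N : ℕ) [NeZero N]

/-- §2 ★ in the `L^{j+1}`-cube currency: on its image bonds the restricted averaging of record is the true average, for a region `Y`
with `IsBlockUnion (L^(j+1)) Y`. [cite: Balaban1988Convergent, (2.21) p.258, (3.1) p.264 (bookkeeping)] -/
theorem avgRestrOfRecord_apply_eq_avOfRecord_of_isBlockUnion_pow (K j : ℕ) [DecidableEq (PBond (F.P K) j)]
    (hj : j + 1 ≤ (F.P K).m + (F.P K).K) {Y : Set (Site (F.P K) 0)}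
    (hY : B10Eq38TorusDomains.IsBlockUnion ((F.P K).L ^ (j + 1)) Y)
    {sV : Finset (PBond (F.P K) j)} (hsV : ∀ b : PBond (F.P K) j, b ∈ bondsIn j Y → b ∈ sV)
    {sV' : Finset (PBond (F.P K) (j + 1))} (hsV' : ∀ c : PBond (F.P K) (j + 1), c ∈ sV' → c ∈ bondsIn (j + 1) Y)
    (U : GaugeField (F.P K) j (SU N)) (c' : ↥sV') :
    avgRestrOfRecord F N K j sV sV' (fun b => U b) c' = (avOfRecord F N K j).avg U c' :=
  avgRestrOfRecord_apply_eq_avOfRecord F N K j hj (toFine_mem_iff_of_isBlockUnion_pow hj hY) hsV hsV' U c'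

/-- §2 ★ in the `(j+1)`-block currency (`B14.Eq22Determines.IsBlockUnion (j+1) Y`). [cite: Balaban1988Convergent, (2.21) p.258, (3.1) p.264 (bookkeeping)] -/
theorem avgRestrOfRecord_apply_eq_avOfRecord_of_isBlockUnion_level (K j : ℕ) [DecidableEq (PBond (F.P K) j)]
    (hj : j + 1 ≤ (F.P K).m + (F.P K).K) {Y : Set (Site (F.P K) 0)}
    (hY : B14.Eq22Determines.IsBlockUnion (j + 1) Y)
    {sV : Finset (PBond (F.P K) j)} (hsV : ∀ b : PBond (F.P K) j, b ∈ bondsIn j Y → b ∈ sV)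
    {sV' : Finset (PBond (F.P K) (j + 1))} (hsV' : ∀ c : PBond (F.P K) (j + 1), c ∈ sV' → c ∈ bondsIn (j + 1) Y)
    (U : GaugeField (F.P K) j (SU N)) (c' : ↥sV') :
    avgRestrOfRecord F N K j sV sV' (fun b => U b) c' = (avOfRecord F N K j).avg U c' :=
  avgRestrOfRecord_apply_eq_avOfRecord F N K j hj (toFine_mem_iff_of_isBlockUnion_level hj hY) hsV hsV' U c'

/-- §2 ★ at 11a's `genDataOfRecord` bond sets when `Ω_{j+1}` is a union of `L^{j+1}`-cubes (then so is its complement,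
`IsBlockUnion.compl`). [cite: Balaban1988Convergent, (2.21) p.258, (3.1) p.264 (bookkeeping)] -/
theorem avgRestrOfRecord_genData_apply_eq_avOfRecord_of_isBlockUnion_pow {V : Type} (ν : Stage7Numerics) (M : ℕ) (g : ℕ → ℝ)
    (K : ℕ) (W : TkWeights F N V K) {k : ℕ} (s : SeqOfRecord F ν M g K k) (S : ℕ → Set (Site (F.P K) 0)) (j : ℕ)
    [DecidableEq (PBond (F.P K) j)] (hj : j + 1 ≤ (F.P K).m + (F.P K).K)
    (hΩ : B10Eq38TorusDomains.IsBlockUnion ((F.P K).L ^ (j + 1)) (s.Ω (j + 1)))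
    (U : GaugeField (F.P K) j (SU N)) (c' : ↥(genDataOfRecord F N V ν M g K W s S j).sV') :
    avgRestrOfRecord F N K j (genDataOfRecord F N V ν M g K W s S j).sV (genDataOfRecord F N V ν M g K W s S j).sV'
        (fun b => U b) c' = (avOfRecord F N K j).avg U c' :=
  avgRestrOfRecord_genData_apply_eq_avOfRecord F N ν M g K W s S j hj (toFine_mem_iff_of_isBlockUnion_pow hj hΩ.compl) U c'

/-- §2 ★ at 11a's `genDataOfRecord` bond sets when `Ω_{j+1}` is a union of `(j+1)`-blocks (`B14.Eq22Determines.IsBlockUnion`; the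
complement of such a region is one too). [cite: Balaban1988Convergent, (2.1) p.255, (2.21) p.258 (bookkeeping)] -/
theorem avgRestrOfRecord_genData_apply_eq_avOfRecord_of_isBlockUnion_level {V : Type} (ν : Stage7Numerics) (M : ℕ) (g : ℕ → ℝ)
    (K : ℕ) (W : TkWeights F N V K) {k : ℕ} (s : SeqOfRecord F ν M g K k) (S : ℕ → Set (Site (F.P K) 0)) (j : ℕ)
    [DecidableEq (PBond (F.P K) j)] (hj : j + 1 ≤ (F.P K).m + (F.P K).K)
    (hΩ : B14.Eq22Determines.IsBlockUnion (j + 1) (s.Ω (j + 1)))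
    (U : GaugeField (F.P K) j (SU N)) (c' : ↥(genDataOfRecord F N V ν M g K W s S j).sV') :
    avgRestrOfRecord F N K j (genDataOfRecord F N V ν M g K W s S j).sV (genDataOfRecord F N V ν M g K W s S j).sV'
        (fun b => U b) c' = (avOfRecord F N K j).avg U c' := by
  have hΩc : B14.Eq22Determines.IsBlockUnion (j + 1) (s.Ω (j + 1))ᶜ := fun x => by
    simp only [Set.mem_compl_iff]
    exact not_congr (hΩ x)
  exact avgRestrOfRecord_genData_apply_eq_avOfRecord F N ν M g K W s S j hj (toFine_mem_iff_of_isBlockUnion_level hj hΩc) U c'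

end OfRecordSaturated

end Literature.MathematicalPhysics.QuantumFieldTheory.Balaban1983to89.Node00

end
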